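import Literature.Topology.FourManifolds.SurfaceGroupLiftableMoves
import Mathlib.Tactic.Group
import HarnessLib

/-!
# The handle slides of the surface group lift to the free group (Nielsen lifts)

Topic `Literature/Topology/FourManifolds`; sequel to `SurfaceGroupLiftableMoves.lean` (the
constructor `SurfaceGroup.liftable_of_gens` and the lifts of the inversion move, the cut swaps
and the handle transvections).  Here the two HANDLE SLIDES `slideEquiv hkl`, `coslideEquiv hkl`
(`k < l`; `SurfaceGroupHandleMoves.lean`: the automorphisms of
`S_g = ⟨a₀, b₀, …, a_{g-1}, b_{g-1} ∣ ∏ᵢ [aᵢ, bᵢ]⟩` with generator images the words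
`HandleWords.slideA/B/C/D`, `coslideA/B/C/D` in `a_k, b_k, a_l, b_l` and the middle block
`mid k l = ∏_{k<h<l} [a_h, b_h]`, lifting Nielsen's transvections `x_k ↦ x_k x_l`, `x_l ↦ x_l x_k`
of `F_g = S_g ⧸ ⟪aᵢ⟫`) are shown to be *liftable* in the sense of Nielsen's theorem
(`nielsen_surfaceGroup_mulEquiv_lift`; hypothesis shape of
`TrisectionKernels.iso_stabilize_map_of_lift`): the same words read in the FREE group
`F⟨a₀, …, b_{g-1}⟩`, with the free middle block `∏_{k<h<l} [a_h, b_h]`, define an automorphism of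
the free group fixing the surface relator `r_g` on the nose (`ε = 1`, `c = 1`) and inducing the
slide — every identity used in `SurfaceGroupHandleMoves.lean` to build the slides is an identity
of the free group.

* `SurfaceGroup.lift_prod_map_relFactor_of` — an endomorphism of the free group fixing the
  generators of the handles strictly between `k` and `l` fixes the free middle block;
* `SurfaceGroup.liftable_slideEquiv`, `SurfaceGroup.liftable_coslideEquiv`.

With `SurfaceGroupLiftableMoves.lean` this makes every generator used in the tree's proof that
`Aut F_g` lifts along the handlebody projection (`SurfaceGroup.liftable_eq_top`,
`SurfaceGroupEpimorphismsStandard.lean`) liftable to `Aut F_{2g}`; the consequence — Nielsen's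
theorem reduces to the twist group of the handlebody — is drawn in
`SurfaceGroupNielsenReduction.lean`.

## References

* J. Nielsen, *Untersuchungen zur Topologie der geschlossenen zweiseitigen Flächen*, Acta Math. 50
  (1927) 189–358, §§ 1–2. [Nielsen1927]
* H. Zieschang, E. Vogt, H.-D. Coldewey, *Surfaces and Planar Discontinuous Groups*, LNM 835
  (1980), §5.1 and Thm. 5.6.1. [ZieschangVogtColdewey1980]
* H. B. Griffiths, *Automorphisms of a 3-dimensional handlebody*, Abh. Math. Sem. Univ. Hamburg
  26 (1964) 191–210. [GriffithsHB1964Handlebody]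
-/

noncomputable section

namespace Literature.Topology.FourManifolds

namespace SurfaceGroup

open HandleWords

variable {g : ℕ}

/-! ## The free middle block is fixed -/

/-- An endomorphism `f̂` of the free group fixing the generators `a_h, b_h` of the handles
`k < h < l` fixes the free middle block `∏_{k<h<l} [a_h, b_h]`. [folklore] -/
theorem lift_prod_map_relFactor_of (f : surfaceGen g → FreeGroup (surfaceGen g)) {k l : ℕ}
    (hf : ∀ i : Fin g, k < i → (i : ℕ) < l → ∀ s, f (i, s) = FreeGroup.of (i, s)) :
    FreeGroup.lift f (((List.range' (k + 1) (l - k - 1)).map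
        (relFactor (FreeGroup.of : surfaceGen g → FreeGroup (surfaceGen g)))).prod) =
      ((List.range' (k + 1) (l - k - 1)).map
        (relFactor (FreeGroup.of : surfaceGen g → FreeGroup (surfaceGen g)))).prod := by
  rw [map_list_prod, List.map_map]
  congr 1
  refine List.map_congr_left fun i hi => ?_
  rw [List.mem_range'_1] at hi
  rw [Function.comp_apply, map_relFactor]
  unfold relFactor
  split_ifs with hig
  · have h1 : (⇑(FreeGroup.lift f) ∘ FreeGroup.of) = f := funext fun p => FreeGroup.lift_apply_of
    rw [h1, hf ⟨i, hig⟩ (show k < i by omega) (show i < l by omega),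
      hf ⟨i, hig⟩ (show k < i by omega) (show i < l by omega)]
  · rfl

section slides

variable {k l : Fin g} (hkl : k < l)
include hkl

/-! ## The handle slide `σ_{kl}` lifts -/

/-- **The handle slide `slideEquiv hkl` is liftable** (`ε = 1`, `c = 1`): the slide words
`HandleWords.slideA/B/C/D` in the free generators `a_k, b_k, a_l, b_l` and the free middle block
(inverse words `slideInvA/B/C/D`) define an automorphism of the free group fixing
`[a_k,b_k] · ∏_{k<h<l}[a_h,b_h] · [a_l,b_l]`, hence `r_g`, on the nose — the action on
`π₁(Σ_g ∖ disc)` of the handle slide, a homeomorphism of `Σ_g` missing the disc (Griffiths 1964).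
[cite: ZieschangVogtColdewey1980, §5.1 and Thm. 5.6.1] -/
theorem liftable_slideEquiv :
    ∃ (φ : FreeGroup (surfaceGen g) ≃* FreeGroup (surfaceGen g)) (c : FreeGroup (surfaceGen g))
      (ε : ℤ), (ε = 1 ∨ ε = -1) ∧ φ (surfaceRelator g) = c * surfaceRelator g ^ ε * c⁻¹ ∧
      ∀ x, PresentedGroup.mk _ (φ x) = slideEquiv hkl (PresentedGroup.mk _ x) := by
  set m : FreeGroup (surfaceGen g) := ((List.range' (k + 1) (l - k - 1)).map
    (relFactor (FreeGroup.of : surfaceGen g → FreeGroup (surfaceGen g)))).prod with hm_def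
  have hmid : PresentedGroup.mk ({surfaceRelator g} : Set (FreeGroup (surfaceGen g))) m = mid k l :=
    mk_prod_map_relFactor_of k l
  set f : surfaceGen g → FreeGroup (surfaceGen g) := fun p =>
    if p.1 = k then (bif p.2 then slideB (genA k) (genB k) (genB l) m else slideA (genA k) (genB l) m)
    else if p.1 = l then
      (bif p.2 then slideD (genA k) (genB l) m else slideC (genA k) (genA l) (genB l) m)
    else FreeGroup.of p with hf_def
  set f' : surfaceGen g → FreeGroup (surfaceGen g) := fun p =>
    if p.1 = k then
      (bif p.2 then slideInvB (genA k) (genB k) (genB l) m else slideInvA (genA k) (genB l) m)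
    else if p.1 = l then
      (bif p.2 then slideInvD (genA k) (genB l) m else slideInvC (genA k) (genA l) (genB l) m)
    else FreeGroup.of p with hf'_def
  have hlk : (l = k) = False := eq_false hkl.ne'
  -- values of `f`, `f'`
  have fA : f (k, false) = slideA (genA k) (genB l) m := by simp [hf_def]
  have fB : f (k, true) = slideB (genA k) (genB k) (genB l) m := by simp [hf_def]
  have fC : f (l, false) = slideC (genA k) (genA l) (genB l) m := by simp [hf_def, hlk]
  have fD : f (l, true) = slideD (genA k) (genB l) m := by simp [hf_def, hlk]
  have f'A : f' (k, false) = slideInvA (genA k) (genB l) m := by simp [hf'_def]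
  have f'B : f' (k, true) = slideInvB (genA k) (genB k) (genB l) m := by simp [hf'_def]
  have f'C : f' (l, false) = slideInvC (genA k) (genA l) (genB l) m := by simp [hf'_def, hlk]
  have f'D : f' (l, true) = slideInvD (genA k) (genB l) m := by simp [hf'_def, hlk]
  have foff : ∀ i : Fin g, i ≠ k → i ≠ l → ∀ s, f (i, s) = FreeGroup.of (i, s) := fun i hik hil s => by
    simp [hf_def, hik, hil]
  have f'off : ∀ i : Fin g, i ≠ k → i ≠ l → ∀ s, f' (i, s) = FreeGroup.of (i, s) :=
    fun i hik hil s => by simp [hf'_def, hik, hil]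
  have fbetw : ∀ i : Fin g, (k : ℕ) < i → (i : ℕ) < l → ∀ s, f (i, s) = FreeGroup.of (i, s) :=
    fun i h1 h2 s => foff i (fun e => by subst e; omega) (fun e => by subst e; omega) s
  have f'betw : ∀ i : Fin g, (k : ℕ) < i → (i : ℕ) < l → ∀ s, f' (i, s) = FreeGroup.of (i, s) :=
    fun i h1 h2 s => f'off i (fun e => by subst e; omega) (fun e => by subst e; omega) s
  -- the two endomorphisms on the atoms
  have gA : FreeGroup.lift f (genA k) = slideA (genA k) (genB l) m := by
    rw [← fA]; exact FreeGroup.lift_apply_of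
  have gB : FreeGroup.lift f (genB k) = slideB (genA k) (genB k) (genB l) m := by
    rw [← fB]; exact FreeGroup.lift_apply_of
  have gC : FreeGroup.lift f (genA l) = slideC (genA k) (genA l) (genB l) m := by
    rw [← fC]; exact FreeGroup.lift_apply_of
  have gD : FreeGroup.lift f (genB l) = slideD (genA k) (genB l) m := by
    rw [← fD]; exact FreeGroup.lift_apply_of
  have gM : FreeGroup.lift f m = m := lift_prod_map_relFactor_of f fbetw
  have g'A : FreeGroup.lift f' (genA k) = slideInvA (genA k) (genB l) m := by
    rw [← f'A]; exact FreeGroup.lift_apply_of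
  have g'B : FreeGroup.lift f' (genB k) = slideInvB (genA k) (genB k) (genB l) m := by
    rw [← f'B]; exact FreeGroup.lift_apply_of
  have g'C : FreeGroup.lift f' (genA l) = slideInvC (genA k) (genA l) (genB l) m := by
    rw [← f'C]; exact FreeGroup.lift_apply_of
  have g'D : FreeGroup.lift f' (genB l) = slideInvD (genA k) (genB l) m := by
    rw [← f'D]; exact FreeGroup.lift_apply_of
  have g'M : FreeGroup.lift f' m = m := lift_prod_map_relFactor_of f' f'betw
  refine liftable_of_gens (slideEquiv hkl) f f' 1 1 (Or.inl rfl) ?_ ?_ ?_ ?_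
  · rw [one_mul, zpow_one, inv_one, mul_one]
    refine lift_surfaceRelator_eq_self_of_block hkl f foff ?_
    rw [← hm_def, fA, fB, fC, fD]
    simp only [slideA, slideB, slideC, slideD]
    group
  · rintro ⟨i, s⟩
    by_cases hik : i = k
    · subst hik; cases s
      · rw [fA]; simp only [slideA, map_mul, map_inv, g'A, g'D, g'M, slideInvA, slideInvD]
        simp only [genA, genB]
        group
      · rw [fB]
        simp only [slideB, map_mul, map_inv, g'A, g'B, g'D, g'M, slideInvA, slideInvB, slideInvD]
        simp only [genA, genB]
        group
    by_cases hil : i = l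
    · subst hil; cases s
      · rw [fC]
        simp only [slideC, map_mul, map_inv, g'A, g'C, g'D, g'M, slideInvA, slideInvC, slideInvD]
        simp only [genA, genB]
        group
      · rw [fD]; simp only [slideD, map_mul, map_inv, g'A, g'D, g'M, slideInvA, slideInvD]
        simp only [genA, genB]
        group
    · rw [foff i hik hil, FreeGroup.lift_apply_of, f'off i hik hil]
  · rintro ⟨i, s⟩
    by_cases hik : i = k
    · subst hik; cases s
      · rw [f'A]; simp only [slideInvA, map_mul, map_inv, gA, gD, gM, slideA, slideD]
        simp only [genA, genB]
        group
      · rw [f'B]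
        simp only [slideInvB, map_mul, map_inv, gA, gB, gD, gM, slideA, slideB, slideD]
        simp only [genA, genB]
        group
    by_cases hil : i = l
    · subst hil; cases s
      · rw [f'C]
        simp only [slideInvC, map_mul, map_inv, gA, gC, gD, gM, slideA, slideC, slideD]
        simp only [genA, genB]
        group
      · rw [f'D]; simp only [slideInvD, map_mul, map_inv, gA, gD, gM, slideA, slideD]
        simp only [genA, genB]
        group
    · rw [f'off i hik hil, FreeGroup.lift_apply_of, foff i hik hil]
  · rintro ⟨i, s⟩
    rw [slideEquiv_of]
    by_cases hik : i = k
    · subst hik; cases s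
      · rw [blockGens_k_false, fA]; simp only [slideA, map_mul, map_inv, mk_genA, mk_genB, hmid]
      · rw [blockGens_k_true, fB]; simp only [slideB, map_mul, map_inv, mk_genA, mk_genB, hmid]
    by_cases hil : i = l
    · subst hil; cases s
      · rw [blockGens_l_false hkl, fC]; simp only [slideC, map_mul, map_inv, mk_genA, mk_genB, hmid]
      · rw [blockGens_l_true hkl, fD]; simp only [slideD, map_mul, map_inv, mk_genA, mk_genB, hmid]
    · rw [blockGens_of_ne _ _ _ _ hik hil, foff i hik hil, mk_freeGroup_of]

/-! ## The handle slide `σ'_{kl}` lifts -/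

/-- **The handle slide `coslideEquiv hkl` is liftable** (`ε = 1`, `c = 1`): the words
`HandleWords.coslideA/B/C/D` in the free generators and the free middle block (inverse words
`coslideInvA/B/C/D`) define an automorphism of the free group fixing the block
`[a_k,b_k] · ∏_{k<h<l}[a_h,b_h] · [a_l,b_l]`, hence `r_g`, on the nose (Griffiths 1964).
[cite: ZieschangVogtColdewey1980, §5.1 and Thm. 5.6.1] -/
theorem liftable_coslideEquiv :
    ∃ (φ : FreeGroup (surfaceGen g) ≃* FreeGroup (surfaceGen g)) (c : FreeGroup (surfaceGen g))
      (ε : ℤ), (ε = 1 ∨ ε = -1) ∧ φ (surfaceRelator g) = c * surfaceRelator g ^ ε * c⁻¹ ∧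
      ∀ x, PresentedGroup.mk _ (φ x) = coslideEquiv hkl (PresentedGroup.mk _ x) := by
  set m : FreeGroup (surfaceGen g) := ((List.range' (k + 1) (l - k - 1)).map
    (relFactor (FreeGroup.of : surfaceGen g → FreeGroup (surfaceGen g)))).prod with hm_def
  have hmid : PresentedGroup.mk ({surfaceRelator g} : Set (FreeGroup (surfaceGen g))) m = mid k l :=
    mk_prod_map_relFactor_of k l
  set f : surfaceGen g → FreeGroup (surfaceGen g) := fun p =>
    if p.1 = k then (bif p.2 then coslideB (genB k) (genA l) m else coslideA (genA k) (genB k) (genA l) m)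
    else if p.1 = l then
      (bif p.2 then coslideD (genB k) (genA l) (genB l) m else coslideC (genB k) (genA l) m)
    else FreeGroup.of p with hf_def
  set f' : surfaceGen g → FreeGroup (surfaceGen g) := fun p =>
    if p.1 = k then (bif p.2 then coslideInvB (genB k) (genA l) m else coslideInvA (genA k) (genA l) m)
    else if p.1 = l then
      (bif p.2 then coslideInvD (genB k) (genA l) (genB l) m else coslideInvC (genB k) (genA l) m)
    else FreeGroup.of p with hf'_def
  have hlk : (l = k) = False := eq_false hkl.ne'
  have fA : f (k, false) = coslideA (genA k) (genB k) (genA l) m := by simp [hf_def]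
  have fB : f (k, true) = coslideB (genB k) (genA l) m := by simp [hf_def]
  have fC : f (l, false) = coslideC (genB k) (genA l) m := by simp [hf_def, hlk]
  have fD : f (l, true) = coslideD (genB k) (genA l) (genB l) m := by simp [hf_def, hlk]
  have f'A : f' (k, false) = coslideInvA (genA k) (genA l) m := by simp [hf'_def]
  have f'B : f' (k, true) = coslideInvB (genB k) (genA l) m := by simp [hf'_def]
  have f'C : f' (l, false) = coslideInvC (genB k) (genA l) m := by simp [hf'_def, hlk]
  have f'D : f' (l, true) = coslideInvD (genB k) (genA l) (genB l) m := by simp [hf'_def, hlk]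
  have foff : ∀ i : Fin g, i ≠ k → i ≠ l → ∀ s, f (i, s) = FreeGroup.of (i, s) := fun i hik hil s => by
    simp [hf_def, hik, hil]
  have f'off : ∀ i : Fin g, i ≠ k → i ≠ l → ∀ s, f' (i, s) = FreeGroup.of (i, s) :=
    fun i hik hil s => by simp [hf'_def, hik, hil]
  have fbetw : ∀ i : Fin g, (k : ℕ) < i → (i : ℕ) < l → ∀ s, f (i, s) = FreeGroup.of (i, s) :=
    fun i h1 h2 s => foff i (fun e => by subst e; omega) (fun e => by subst e; omega) s
  have f'betw : ∀ i : Fin g, (k : ℕ) < i → (i : ℕ) < l → ∀ s, f' (i, s) = FreeGroup.of (i, s) :=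
    fun i h1 h2 s => f'off i (fun e => by subst e; omega) (fun e => by subst e; omega) s
  have gA : FreeGroup.lift f (genA k) = coslideA (genA k) (genB k) (genA l) m := by
    rw [← fA]; exact FreeGroup.lift_apply_of
  have gB : FreeGroup.lift f (genB k) = coslideB (genB k) (genA l) m := by
    rw [← fB]; exact FreeGroup.lift_apply_of
  have gC : FreeGroup.lift f (genA l) = coslideC (genB k) (genA l) m := by
    rw [← fC]; exact FreeGroup.lift_apply_of
  have gD : FreeGroup.lift f (genB l) = coslideD (genB k) (genA l) (genB l) m := by
    rw [← fD]; exact FreeGroup.lift_apply_of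
  have gM : FreeGroup.lift f m = m := lift_prod_map_relFactor_of f fbetw
  have g'A : FreeGroup.lift f' (genA k) = coslideInvA (genA k) (genA l) m := by
    rw [← f'A]; exact FreeGroup.lift_apply_of
  have g'B : FreeGroup.lift f' (genB k) = coslideInvB (genB k) (genA l) m := by
    rw [← f'B]; exact FreeGroup.lift_apply_of
  have g'C : FreeGroup.lift f' (genA l) = coslideInvC (genB k) (genA l) m := by
    rw [← f'C]; exact FreeGroup.lift_apply_of
  have g'D : FreeGroup.lift f' (genB l) = coslideInvD (genB k) (genA l) (genB l) m := by
    rw [← f'D]; exact FreeGroup.lift_apply_of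
  have g'M : FreeGroup.lift f' m = m := lift_prod_map_relFactor_of f' f'betw
  refine liftable_of_gens (coslideEquiv hkl) f f' 1 1 (Or.inl rfl) ?_ ?_ ?_ ?_
  · rw [one_mul, zpow_one, inv_one, mul_one]
    refine lift_surfaceRelator_eq_self_of_block hkl f foff ?_
    rw [← hm_def, fA, fB, fC, fD]
    simp only [coslideA, coslideB, coslideC, coslideD]
    group
  · rintro ⟨i, s⟩
    by_cases hik : i = k
    · subst hik; cases s
      · rw [fA]
        simp only [coslideA, map_mul, map_inv, g'A, g'B, g'C, g'M, coslideInvA, coslideInvB,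
          coslideInvC]
        simp only [genA, genB]
        group
      · rw [fB]
        simp only [coslideB, map_mul, map_inv, g'B, g'C, g'M, coslideInvB, coslideInvC]
        simp only [genA, genB]
        group
    by_cases hil : i = l
    · subst hil; cases s
      · rw [fC]
        simp only [coslideC, map_mul, map_inv, g'B, g'C, g'M, coslideInvB, coslideInvC]
        simp only [genA, genB]
        group
      · rw [fD]
        simp only [coslideD, map_mul, map_inv, g'B, g'C, g'D, g'M, coslideInvB, coslideInvC,
          coslideInvD]
        simp only [genA, genB]
        group
    · rw [foff i hik hil, FreeGroup.lift_apply_of, f'off i hik hil]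
  · rintro ⟨i, s⟩
    by_cases hik : i = k
    · subst hik; cases s
      · rw [f'A]
        simp only [coslideInvA, map_mul, map_inv, gA, gC, gM, coslideA, coslideC]
        simp only [genA, genB]
        group
      · rw [f'B]
        simp only [coslideInvB, map_mul, map_inv, gB, gC, gM, coslideB, coslideC]
        simp only [genA, genB]
        group
    by_cases hil : i = l
    · subst hil; cases s
      · rw [f'C]
        simp only [coslideInvC, map_mul, map_inv, gB, gC, gM, coslideB, coslideC]
        simp only [genA, genB]
        group
      · rw [f'D]
        simp only [coslideInvD, map_mul, map_inv, gB, gC, gD, gM, coslideB, coslideC, coslideD]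
        simp only [genA, genB]
        group
    · rw [f'off i hik hil, FreeGroup.lift_apply_of, foff i hik hil]
  · rintro ⟨i, s⟩
    rw [coslideEquiv_of]
    by_cases hik : i = k
    · subst hik; cases s
      · rw [blockGens_k_false, fA]; simp only [coslideA, map_mul, map_inv, mk_genA, mk_genB, hmid]
      · rw [blockGens_k_true, fB]; simp only [coslideB, map_mul, map_inv, mk_genA, mk_genB, hmid]
    by_cases hil : i = l
    · subst hil; cases s
      · rw [blockGens_l_false hkl, fC]; simp only [coslideC, map_mul, map_inv, mk_genA, mk_genB, hmid]
      · rw [blockGens_l_true hkl, fD]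
        simp only [coslideD, map_mul, map_inv, mk_genA, mk_genB, hmid]
    · rw [blockGens_of_ne _ _ _ _ hik hil, foff i hik hil, mk_freeGroup_of]

end slides

end SurfaceGroup

end Literature.Topology.FourManifolds

end
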